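import Summits.BirchSwinnertonDyer.Rank1Residual.X2.Cells
import Literature.NumberTheory.EllipticCurves.Greenberg1999.EulerCharacteristicNonsplitMultiplicativeAnyPrime
import Literature.NumberTheory.EllipticCurves.Wuthrich2014.MainConjectureConverseProofs
import Literature.NumberTheory.EllipticCurves.Wuthrich2014.ReducibleMultiplicativeDivisibility
import Literature.NumberTheory.EllipticCurves.PAdicLFunctionMultiplicativeInterpolation
import HarnessLib

/-!
# Class X2, NON-SPLIT multiplicative Eisenstein prime: the CONVERSE of Kato–Wuthrich's chain —
# `ord_p(L(E,1)/Ω_E) ≤ ord_p #Ш + ord_p ∏ c_ℓ − 2 ord_p #E(ℚ)_tors` ⟹ Mazur's main conjecture at the pair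
# (cell `bsd-eis`, seat `bsd-eis-k5-c3` gen 6; rung K5 crux 3 `MazurMCOnCellB` = stmt-BirchSwinnertonDyer-19033;
# row A10 non-split; THEOREMS ONLY; file 1 of 3 — consequences in `X2/NonsplitShaUnitMainConjecture.lean`,
# the route-G heads with a non-split multiplicative relative in `X2/CongruenceTransferNonsplitShaUnit.lean`)

HONEST FRAMING (FULL-BSD rank-≤1 programme D-0033, cell `bsd-eis`, home `run/shared/lean/pub/bsd-eis/`;
row A10 = corner X2b: `(E₀, 3)`, `r = 0`, multiplicative Eisenstein `3`, `¬GVPar`; 44 non-split cells).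
Nothing booked, no label moves; the class-wide crux `MazurMCOnCellB` is NOT claimed — these files type
its NON-SPLIT half per pair and add one per-pair certificate road. Theorems only (no definition, no
named fact, nothing asserted): every published theorem enters as one of the tree's existing NAMED
FACTS, taken as a hypothesis.

THE POINT. The tree's X1 converse (`Wuthrich2014.mainConjecture_of_padicValRat_le`,
`…_iff_bsdp`: at a reducible GOOD ordinary `p ≠ 2`, `r_an = 0`, Mazur's main conjecture ⟺ Miller's
`BSD(E,p)`, from Wuthrich 2014 Thm. 16 + Greenberg LNM 1716 Thm. 4.1) has an X2-NON-SPLIT twin, because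
both of its inputs exist at a NON-SPLIT MULTIPLICATIVE prime in the tree's Literature:
* Kato's divisibility at an odd multiplicative prime with `E[p]` reducible — Wuthrich 2014 Thm. 16,
  tree fact `thm16_charIdeal_dvd_multiplicative_of_reducible` (`hWu`, a binder of the K5 route's
  `PublishedInputs`): `ι g = ϖ · L_p` for some `g ∈ char_Λ X(E/ℚ_∞)`, `L_p` THE non-split
  Mazur–Tate–Teitelbaum function (`IsMultPAdicLFunctionOf f p (-1) L`, constant term `2·[0]⁺_f`, NO
  exceptional zero — `IsMultPAdicLFunctionOf.constantCoeff_of_neg_one`);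
* the Euler-characteristic formula at a non-split multiplicative `v ∣ p`, `p` odd — Greenberg, LNM 1716,
  §4 pp. 112–113 "the analogue of theorem 4.1" (`l_v = |ker r_v|/c_v^{(p)} = 1`), tree fact
  `Greenberg1999.thm41Analogue_charValue_rankZero_numberField` (`h41`, b2b registry A103, flag
  `Gr99-Thm41-analogue-display`): `f_E(0)·#E(ℚ)[p^∞]² = u·p^{ord_p ∏ c_ℓ}·#Sel_{p^∞}(E/ℚ)`.
With `g = h · f_E` (`h ∈ Λ`), taking constant terms and valuations gives
`ord_p(L(E,1)/Ω_E) + 2 ord_p #E(ℚ)_tors = ord_p h(0) + ord_p ∏ c_ℓ + ord_p #Ш`, `ord_p h(0) ≥ 0`;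
the REVERSE rank-`0` inequality (⟸ `ord_p #Ш_an ≤ ord_p #Ш` ⟸ `BSD(E,p)` ⟸ `p ∤ #Ш_an` by Wuthrich
Prop. 21 — see file 2) forces `ord_p h(0) = 0`, `h ∈ Λˣ`, hence `char_Λ X = (f_E)` with
`ι(f_E · h) = ϖ · L_p`: the non-split clause of the tree's `X2.MazurMainConjectureAt W p`, VERBATIM
(the split clause is vacuous).

Contents: §0 `charValue_nonsplit_rat_of_thm41Analogue` — the `F = ℚ` reading of the registered
number-field fact A103 (pattern of `…_anyPrime.nonsplit_rat`; bookkeeping); §1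
`mazurMainConjectureAt_of_padicValRat_le_of_nonsplit` — the core converse (inputs `hWu h41`).

References: [Wuthrich2014] Thm. 16 (p. 397), Cor. 19 (p. 398); [GreenbergLNM1716] Thm. 4.1 (p. 102),
§4 pp. 112–113 ("the analogue of theorem 4.1"), §5 (closing examples); [MazurTateTeitelbaum1986] §I.10,
§I.14; [CastellaEtAl2021] Thm. 5.1.4 (proof) — the same computation with the equality.
-/

set_option autoImplicit false

noncomputable section

open scoped Classical MatrixGroups ModularForm NumberField

open PowerSeries CongruenceSubgroup WeierstrassCurve NumberField IsDedekindDomain Rat.HeightOneSpectrum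
  Literature.NumberTheory.EllipticCurves
  Literature.NumberTheory.EllipticCurves.ModularForms
  Literature.NumberTheory.EllipticCurves.Rank1Residual
  Literature.NumberTheory.EllipticCurves.Rank1Residual.Typed
  Literature.NumberTheory.EllipticCurves.Wuthrich2014
  Literature.NumberTheory.EllipticCurves.Greenberg1999

namespace Summit.BirchSwinnertonDyer.Rank1Residual.X2

/-! ## §0. The registered number-field fact A103 read at `F = ℚ` -/

section RatReading

variable (W : WeierstrassCurve ℚ) [W.IsElliptic] (p : ℕ) [Fact p.Prime]

/-- **Greenberg's "analogue of theorem 4.1" at a NON-SPLIT multiplicative rational prime `p ≠ 2`,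
read at `F = ℚ`** from the registered number-field fact
`Greenberg1999.thm41Analogue_charValue_rankZero_numberField` (b2b registry A103): for the
cyclotomic `ℤ_p`-extension `κ` with topological generator `γ`, a dual datum `D` with `X` finitely
generated torsion and `char X = (f_E)`, and `Sel_{p^∞}(E/ℚ)` finite,
`f_E(0)·#E(ℚ)[p^∞]² = u · p^{ord_p ∏_ℓ c_ℓ} · #Sel_{p^∞}(E/ℚ)` for some `u ∈ ℤ_pˣ` (`l_p = 1`, `p` odd;
`∏_ℓ c_ℓ = W.tamagawaProduct` over ALL bad primes INCLUDING `p`, where `c_p ∈ {1,2}` is a `p`-adic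
unit anyway). Bookkeeping projection, the pattern of
`thm41Analogue_charValue_rankZero_numberField_anyPrime.nonsplit_rat` (the only place of `𝓞 ℚ` above
`p` is `v_p`; multiplicative / split reduction at the rational prime transported to `v_p`).
[cite: GreenbergLNM1716, §4 pp. 112–113 ("the analogue of theorem 4.1"; "If p is odd, then both |ker(r_v)| and c_v^(p) are equal to 1")] -/
theorem charValue_nonsplit_rat_of_thm41Analogue (h41 : thm41Analogue_charValue_rankZero_numberField)
    (hp2 : p ≠ 2) (hmult : W.HasMultiplicativeReductionAtPrime p)
    (hns : ¬ W.HasSplitMultiplicativeReductionAtPrime p)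
    (κ : ZpExtension ℚ p) (γ : Field.absoluteGaloisGroup ℚ) (hκ : κ.IsCyclotomic)
    (hγ : κ.IsTopGenerator γ) (D : W.SelmerDualData κ γ) [Module.Finite (IwasawaAlgebra p) D.X]
    (hX : D.IsTorsion) (fE : IwasawaAlgebra p) (hfE : D.charIdeal = Ideal.span {fE})
    (hfin : Finite (W.selmerGroupPInfty p)) :
    ∃ u : ℤ_[p]ˣ,
      ((PowerSeries.constantCoeff fE : ℤ_[p]) : ℚ_[p]) *
          (Nat.card (AddCommGroup.primaryComponent W.toAffine.Point p) : ℚ_[p]) ^ 2 =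
        ((u : ℤ_[p]) : ℚ_[p]) * (p : ℚ_[p]) ^ (padicValNat p W.tamagawaProduct) *
          (Nat.card (W.selmerGroupPInfty p) : ℚ_[p]) := by
  -- the place `v_p` of `𝓞 ℚ` above `p`
  set v : HeightOneSpectrum (𝓞 ℚ) := (primesEquiv (R := 𝓞 ℚ)).symm ⟨p, Fact.out⟩ with hv
  have hS : {w : HeightOneSpectrum (𝓞 ℚ) | ((p : ℕ) : 𝓞 ℚ) ∈ w.asIdeal} = {v} := by
    ext w
    simp only [Set.mem_setOf_eq, Set.mem_singleton_iff]
    exact natCast_mem_asIdeal_iff_eq_primesEquiv_symm w (Fact.out : p.Prime)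
  have hq : primesEquiv v = ⟨p, Fact.out⟩ := Equiv.apply_symm_apply _ _
  have hqp : ((primesEquiv v : Nat.Primes) : ℕ) = p := by rw [hq]
  -- non-split multiplicative at `v_p`
  have hmult' : W.HasMultiplicativeReductionAt v := by
    refine (hasMultiplicativeReductionAtPrime_iff_hasMultiplicativeReductionAt_ringOfIntegers
      (W := W) v).mp ?_
    have key : ∀ (q : ℕ) (hq' : Fact q.Prime), q = p → W.HasMultiplicativeReductionAtPrime q := by
      rintro q hq' rfl
      exact hmult
    exact key _ _ hqp
  have hns' : ¬ W.HasSplitMultiplicativeReductionAt v := by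
    intro hsplit
    have hsplit' := (hasSplitMultiplicativeReductionAtPrime_iff_hasSplitMultiplicativeReductionAt
      W v).mpr hsplit
    have key : ∀ (q : ℕ) (hq' : Fact q.Prime), q = p →
        (haveI := hq'; W.HasSplitMultiplicativeReductionAtPrime q) →
        W.HasSplitMultiplicativeReductionAtPrime p := by
      rintro q hq' rfl h'
      exact h'
    exact hns (key _ _ hqp hsplit')
  obtain ⟨u, hu⟩ := thm41Analogue_charValue_rankZero_numberField.of_unique_prime_nonsplit h41 W p hp2
    v hS hmult' hns' κ γ hκ hγ D hX fE hfE hfin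
  refine ⟨u, ?_⟩
  -- the `DecidableEq ℚ` instances hidden in `AddCommGroup (W.toAffine.Point)` may differ
  have hdec : (fun a b : ℚ => Classical.propDecidable (a = b)) = instDecidableEqRat :=
    Subsingleton.elim _ _
  rw [hdec] at hu
  exact hu

end RatReading

/-! ## §1. The core converse at a NON-SPLIT multiplicative prime -/

section Converse

variable (W : WeierstrassCurve ℚ) [W.IsElliptic] [W.IsGloballyMinimal] (p : ℕ) [Fact p.Prime]

/-- `2` is a `p`-adic unit for `p ≠ 2` (as an element of `ℚ_p` coming from `ℤ_pˣ`). [folklore] -/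
private theorem exists_unit_coe_eq_two (hp2 : p ≠ 2) : ∃ u : ℤ_[p]ˣ, ((u : ℤ_[p]) : ℚ_[p]) = 2 := by
  have hcop : p.Coprime 2 := (Nat.coprime_primes (Fact.out : p.Prime) Nat.prime_two).mpr hp2
  have hunit : IsUnit ((2 : ℕ) : ℤ_[p]) := by
    rw [PadicInt.isUnit_iff]
    exact (PadicInt.norm_natCast_eq_one_iff (p := p) (n := 2)).mpr hcop
  refine ⟨hunit.unit, ?_⟩
  rw [IsUnit.unit_spec]
  push_cast
  rfl

/-- **The converse of the chain at a NON-SPLIT multiplicative Eisenstein prime, core form.** Let `W`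
be a globally minimal model of `E/ℚ`, `p ≠ 2` a prime of NON-SPLIT multiplicative reduction
(`hmult`, `hns`) with `E[p]` reducible (`hred`), `L(E,1) ≠ 0` (`hL`) and `Ш(E/ℚ)` finite (`hfin`).
Assume Wuthrich's Thm. 16 at a multiplicative prime (`hWu`, named fact
`thm16_charIdeal_dvd_multiplicative_of_reducible`), Greenberg's "analogue of theorem 4.1" at a
non-split `v ∣ p` (`h41`, named fact `Greenberg1999.thm41Analogue_charValue_rankZero_numberField`),
and the REVERSE rank-`0` inequality
`ord_p(L(E,1)/Ω_E) ≤ ord_p #Ш + ord_p ∏ c_ℓ − 2 ord_p #E(ℚ)_tors` (`hlow`). Then the tree's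
`X2.MazurMainConjectureAt W p` holds: for the cyclotomic `κ, γ`, every newform `f` of `E`, every dual
datum `D` and every `ϖ` with `ϖ · Ω_E = Ω⁺_f`, `X` is `Λ`-torsion, `char_Λ X = (f_E)`, and for THE
non-split Mazur–Tate–Teitelbaum function `L` (`IsMultPAdicLFunctionOf f p (-1) L`) there is `w ∈ Λˣ`
with `ι(f_E · w) = ϖ · L` (the split clause is vacuous). Proof: Thm. 16 gives `g = h · f_E ∈ char_Λ X`
with `ι g = ϖ L`; `L(0) = 2[0]⁺_f`, so `g(0) = 2 L(E,1)/Ω_E ≠ 0`; the analogue of Thm. 4.1 gives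
`f_E(0)·#E(ℚ)[p^∞]² = u·p^{ord_p ∏ c}·#Ш[p^∞]`; valuations give
`ord_p(L(E,1)/Ω_E) + 2 ord_p #E(ℚ)_tors = ord_p h(0) + ord_p ∏ c_ℓ + ord_p #Ш` with `ord_p h(0) ≥ 0`,
and `hlow` forces `ord_p h(0) = 0`, `h ∈ Λˣ` (`PowerSeries.isUnit_iff_constantCoeff`), `w := h`.
Greenberg, LNM 1716 §5 (closing examples), is this argument with `f^anal ∈ Λˣ`; Wuthrich's integral
divisibility makes it general, exactly as in the X1 twin `Wuthrich2014.mainConjecture_of_padicValRat_le`.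
[cite: Wuthrich2014, Thm. 16 (p. 397)] [cite: GreenbergLNM1716, §4 pp. 112–113 ("the analogue of theorem 4.1") and §5 (closing examples)]
[cite: MazurTateTeitelbaum1986, §I.10 (ε(p) = 0), §I.14] -/
theorem mazurMainConjectureAt_of_padicValRat_le_of_nonsplit
    (hWu : thm16_charIdeal_dvd_multiplicative_of_reducible)
    (h41 : thm41Analogue_charValue_rankZero_numberField) (hp2 : p ≠ 2)
    (hmult : W.HasMultiplicativeReductionAtPrime p) (hns : ¬ W.HasSplitMultiplicativeReductionAtPrime p)
    (hred : ¬ W.HasIrreducibleModPGaloisRep p) (hL : W.entireLFunction 1 ≠ 0) (hfin : Finite W.sha)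
    (hlow : ∀ q : ℚ, W.entireLFunction 1 / (W.realPeriodRat : ℂ) = (q : ℂ) →
      padicValRat p q ≤ (padicValNat p W.shaOrder : ℤ) + padicValNat p W.tamagawaProduct -
        2 * padicValNat p W.torsionOrder) :
    X2.MazurMainConjectureAt W p := by
  intro κ γ hκ hγ hγ' N _ f hf D ϖ hϖ
  have hpP : p.Prime := Fact.out
  -- Step 0: the rational number `t = ϖ · [0]⁺_f = L(E,1)/Ω_E`, non-zero
  have hΩpos : 0 < W.realPeriodRat := W.realPeriodRat_pos_holds
  have hϖ0 : ϖ ≠ 0 := by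
    rintro rfl
    have hper : 0 < plusPeriod f := IsNewform0.plusPeriod_pos_holds hf.1 hf.coeffField_eq_bot
    rw [← hϖ, Rat.cast_zero, zero_mul] at hper
    exact lt_irrefl _ hper
  set s : ℚ := ratPlusSymbol f 0 with hs_def
  set t : ℚ := ϖ * s with ht_def
  have hLval : W.entireLFunction 1 = (((s : ℝ) * plusPeriod f : ℝ) : ℂ) := hf.entireLFunction_one_eq
  have hq : W.entireLFunction 1 / (W.realPeriodRat : ℂ) = ((t : ℚ) : ℂ) := by
    rw [hLval, ← hϖ, div_eq_iff (Complex.ofReal_ne_zero.mpr hΩpos.ne'), ht_def]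
    push_cast
    ring
  have hs0 : s ≠ 0 := by
    intro h0
    apply hL
    rw [hLval, h0]
    simp
  have ht0 : t ≠ 0 := mul_ne_zero hϖ0 hs0
  have hle : padicValRat p t ≤ (padicValNat p W.shaOrder : ℤ) + padicValNat p W.tamagawaProduct -
      2 * padicValNat p W.torsionOrder := hlow t hq
  -- Step 1 (the Iwasawa module; Wuthrich's Thm. 16 at the multiplicative prime): `X` torsion, the
  -- non-split divisibility clause; a generator `fE` of the (principal) characteristic ideal
  haveI : Module.Finite (IwasawaAlgebra p) D.X := D.module_finite_holds hγ
  obtain ⟨hX, hnsp, -⟩ := hWu W p hp2 hmult hred hκ hγ hγ' hf D ϖ hϖ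
  haveI : (Module.charIdeal (IwasawaAlgebra p) D.X).IsPrincipal := charIdeal_isPrincipal_holds p D.X
  obtain ⟨fE, hchar⟩ := Submodule.IsPrincipal.principal (Module.charIdeal (IwasawaAlgebra p) D.X)
  have hchar' : D.charIdeal = Ideal.span {fE} := hchar
  refine ⟨hX, fE, hchar', fun hsplit ↦ absurd hsplit hns, fun _ L hLp ↦ ?_⟩
  -- Step 2: the cofactor `h`, `g = h · fE`, `ι g = ϖ · L`
  obtain ⟨g, hgmem, hιg⟩ := hnsp hns L hLp
  have hgmem' : g ∈ Ideal.span {fE} := by rw [← hchar']; exact hgmem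
  obtain ⟨h, hgh⟩ := Ideal.mem_span_singleton'.mp hgmem'
  -- Step 3 (interpolation at a non-split prime): `g(0) = ϖ · 2 · [0]⁺_f = 2 t`
  have htcast : ((t : ℚ) : ℚ_[p]) = (ϖ : ℚ_[p]) * (s : ℚ_[p]) := by
    rw [ht_def]; push_cast; ring
  have hg0 : ((PowerSeries.constantCoeff g : ℤ_[p]) : ℚ_[p]) = 2 * (t : ℚ_[p]) := by
    rw [← constantCoeff_iwasawaToPowerSeries p g, hιg, map_mul, PowerSeries.constantCoeff_C,
      hLp.constantCoeff_of_neg_one, htcast]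
    ring
  have hg0' : (PowerSeries.constantCoeff g : ℤ_[p]) =
      PowerSeries.constantCoeff h * PowerSeries.constantCoeff fE := by
    rw [← hgh, map_mul]
  obtain ⟨u₂, hu₂⟩ := exists_unit_coe_eq_two p hp2
  have h2ne : (2 : ℚ_[p]) ≠ 0 := by rw [← hu₂]; exact coe_units_ne_zero p u₂
  have h2val : (2 : ℚ_[p]).valuation = 0 := by rw [← hu₂, valuation_coe_units_eq_zero]
  have htQ0 : (t : ℚ_[p]) ≠ 0 := by exact_mod_cast ht0
  -- Step 4 (finiteness): `g(0) ≠ 0`, hence `fE(0) ≠ 0`, `h(0) ≠ 0`, so `Sel_{p^∞}(E/ℚ)`, `E(ℚ)` finite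
  have hg00 : PowerSeries.constantCoeff g ≠ 0 := by
    intro h0
    rw [h0, PadicInt.coe_zero] at hg0
    exact (mul_ne_zero h2ne htQ0) hg0.symm
  have hfE00 : PowerSeries.constantCoeff fE ≠ 0 := by
    intro h0
    apply hg00
    rw [hg0', h0, mul_zero]
  have hh00 : PowerSeries.constantCoeff h ≠ 0 := by
    intro h0
    apply hg00
    rw [hg0', h0, zero_mul]
  have hSelfin : Finite (W.selmerGroupPInfty p) :=
    D.finite_selmerGroupPInfty_of_constantCoeff_ne_zero W hγ hX fE hchar' hfE00
  obtain ⟨hEfin, hShapfin⟩ := (W.finite_selmerGroupPInfty_iff p).mp hSelfin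
  haveI := hEfin
  haveI := hShapfin
  haveI := hSelfin
  haveI : Finite W.sha := hfin
  -- Step 5 (Greenberg's analogue of Thm. 4.1 at the non-split prime — the named fact — for `fE`)
  obtain ⟨u₁, hu₁⟩ := charValue_nonsplit_rat_of_thm41Analogue W p h41 hp2 hmult hns κ γ hκ hγ D hX fE
    hchar' hSelfin
  -- Step 6 (the remaining bridges)
  obtain ⟨u₄, hu₄⟩ := exists_unit_torsionOrder_eq W p
  obtain ⟨u₅, hu₅⟩ := exists_unit_natCard_eq_mul_card_primaryComponent W.sha p
  have hSel : Nat.card (W.selmerGroupPInfty p) = Nat.card (AddCommGroup.primaryComponent W.sha p) :=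
    W.natCard_selmerGroupPInfty_eq_natCard_primaryComponent_sha p
  set v := padicValNat p W.tamagawaProduct with hv
  set Tp : ℚ_[p] := (Nat.card (AddCommGroup.primaryComponent W.toAffine.Point p) : ℚ_[p]) with hTp
  set Shp : ℚ_[p] := (Nat.card (AddCommGroup.primaryComponent W.sha p) : ℚ_[p]) with hShp
  set h0 : ℚ_[p] := ((PowerSeries.constantCoeff h : ℤ_[p]) : ℚ_[p]) with hh0
  have hh0ne : h0 ≠ 0 := by
    rw [hh0]
    intro h0'
    exact hh00 (by exact_mod_cast (PadicInt.coe_eq_zero.mp h0'))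
  have hh0val : 0 ≤ h0.valuation := by
    rw [hh0]
    exact PadicInt.valuation_coe_nonneg
  have hu₄' : (W.torsionOrder : ℚ_[p]) = ((u₄ : ℤ_[p]) : ℚ_[p]) * Tp := by
    rw [hu₄, hTp]
    congr 1
    exact_mod_cast natCard_primaryComponent_point_congr W p _ _
  have hSha : (W.shaOrder : ℚ_[p]) = ((u₅ : ℤ_[p]) : ℚ_[p]) * Shp := by
    rw [WeierstrassCurve.shaOrder, hShp]
    exact hu₅
  have hSel' : (Nat.card (W.selmerGroupPInfty p) : ℚ_[p]) = Shp := by rw [hShp, hSel]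
  have hg0Q : ((PowerSeries.constantCoeff g : ℤ_[p]) : ℚ_[p]) =
      h0 * ((PowerSeries.constantCoeff fE : ℤ_[p]) : ℚ_[p]) := by
    rw [hg0', hh0]; push_cast; ring
  -- Step 7: the identity `2 · t · Tp² = h0 · u₁ · p^v · Shp` in `ℚ_p`
  have key : 2 * (t : ℚ_[p]) * Tp ^ 2 = h0 * (((u₁ : ℤ_[p]) : ℚ_[p]) * (p : ℚ_[p]) ^ v * Shp) := by
    calc 2 * (t : ℚ_[p]) * Tp ^ 2
        = ((PowerSeries.constantCoeff g : ℤ_[p]) : ℚ_[p]) * Tp ^ 2 := by rw [hg0]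
      _ = h0 * (((PowerSeries.constantCoeff fE : ℤ_[p]) : ℚ_[p]) * Tp ^ 2) := by rw [hg0Q]; ring
      _ = h0 * (((u₁ : ℤ_[p]) : ℚ_[p]) * (p : ℚ_[p]) ^ v *
            (Nat.card (W.selmerGroupPInfty p) : ℚ_[p])) := by rw [hu₁]
      _ = h0 * (((u₁ : ℤ_[p]) : ℚ_[p]) * (p : ℚ_[p]) ^ v * Shp) := by rw [hSel']
  -- Step 8: valuations
  have hTp0 : Tp ≠ 0 := by rw [hTp]; exact_mod_cast Nat.card_pos.ne'
  have hShp0 : Shp ≠ 0 := by rw [hShp]; exact_mod_cast Nat.card_pos.ne'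
  have hp0 : (p : ℚ_[p]) ≠ 0 := Nat.cast_ne_zero.mpr hpP.ne_zero
  have hval := congrArg Padic.valuation key
  rw [Padic.valuation_mul (mul_ne_zero h2ne htQ0) (pow_ne_zero 2 hTp0),
    Padic.valuation_mul h2ne htQ0, h2val, Padic.valuation_pow,
    Padic.valuation_mul hh0ne
      (mul_ne_zero (mul_ne_zero (coe_units_ne_zero p u₁) (pow_ne_zero v hp0)) hShp0),
    Padic.valuation_mul (mul_ne_zero (coe_units_ne_zero p u₁) (pow_ne_zero v hp0)) hShp0,
    Padic.valuation_mul (coe_units_ne_zero p u₁) (pow_ne_zero v hp0), valuation_coe_units_eq_zero,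
    Padic.valuation_pow, Padic.valuation_p, Padic.valuation_ratCast] at hval
  have hvT : Tp.valuation = (padicValNat p W.torsionOrder : ℤ) := by
    have h := congrArg Padic.valuation hu₄'
    rw [Padic.valuation_natCast, Padic.valuation_mul (coe_units_ne_zero p u₄) hTp0,
      valuation_coe_units_eq_zero, zero_add] at h
    exact h.symm
  have hvS : Shp.valuation = (padicValNat p W.shaOrder : ℤ) := by
    have h := congrArg Padic.valuation hSha
    rw [Padic.valuation_natCast, Padic.valuation_mul (coe_units_ne_zero p u₅) hShp0,
      valuation_coe_units_eq_zero, zero_add] at h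
    exact h.symm
  rw [hvT, hvS] at hval
  simp only [Nat.cast_ofNat, zero_add] at hval
  -- Step 9: the reverse inequality forces `ord_p h(0) = 0`, so `h(0) ∈ ℤ_pˣ` and `h ∈ Λˣ`
  have hh0zero : h0.valuation = 0 := by linarith
  have hvalh : (PowerSeries.constantCoeff h : ℤ_[p]).valuation = 0 := by
    have h' : (((PowerSeries.constantCoeff h : ℤ_[p]) : ℚ_[p])).valuation = 0 := by
      rw [← hh0]; exact hh0zero
    rw [PadicInt.valuation_coe] at h'
    exact_mod_cast h'
  have hunit0 : IsUnit (PowerSeries.constantCoeff h : ℤ_[p]) := by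
    rw [PadicInt.isUnit_iff, PadicInt.norm_eq_zpow_neg_valuation hh00, hvalh]
    simp
  have hunit : IsUnit h := PowerSeries.isUnit_iff_constantCoeff.mpr hunit0
  -- Step 10: `w := h`, `ι(fE · w) = ι(h · fE) = ι g = ϖ · L`
  refine ⟨hunit.unit, ?_⟩
  rw [IsUnit.unit_spec, mul_comm, hgh, hιg]


end Converse

end Summit.BirchSwinnertonDyer.Rank1Residual.X2

end
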